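import Summits.ResolutionOfSingularities.ResolutionOfSingularities.Theorems.ValuativeLuAlphaPTorsorDiscreteAllDim
import Mathlib.RingTheory.DiscreteValuationRing.Basic

/-!
# `LuAlphaPTorsor` along every DISCRETE VALUATION RING (corollary of `luAlphaPTorsor_of_discrete`)

Crux `Valuative.LuAlphaPTorsor` (item `stmt-ResolutionOfSingularities-0641`), line
`pfaff-line-log-final-forms`, branch `DiscreteAllDim`. The landed `luAlphaPTorsor_of_discrete`
takes discreteness in the elementary form "some `π ≠ 0` of value `< 1` such that every non-zero
value is an integral power of `v(π)`"; here it is restated in Mathlib's vocabulary: the crux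
holds along every valuation ring `O` of `K` which is a discrete valuation ring
(`IsDiscreteValuationRing O`, i.e. a Noetherian valuation ring which is not a field), in every
base dimension and for every ground field of characteristic `p` — a uniformizer `ϖ` of `O`
(`IsDiscreteValuationRing.exists_irreducible`) is such a `π`, since every non-zero element of
`O` is a unit times a power of `ϖ` (`IsDiscreteValuationRing.eq_unit_mul_pow_irreducible`) and
every element of `K` is a quotient of two elements of `O`.
-/

set_option linter.dupNamespace false

namespace Summit.ResolutionOfSingularities.ResolutionOfSingularities.Theorems.PfaffLine

open IsLocalRing

/-- In a valuation ring of `K` which is a discrete valuation ring, a uniformizer `ϖ` generates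
the value group: every non-zero element of `K` has value `v(ϖ) ^ n` for some `n : ℤ`.
[folklore] -/
theorem exists_zpow_valuation_of_isDiscreteValuationRing {K : Type} [Field K]
    (O : ValuationSubring K) [IsDiscreteValuationRing O] {ϖ : O} (hϖ : Irreducible ϖ)
    (z : K) (hz : z ≠ 0) : ∃ n : ℤ, O.valuation z = O.valuation (ϖ : K) ^ n := by
  -- the value of a non-zero element of `O`
  have hO : ∀ x : O, x ≠ 0 → ∃ m : ℕ, O.valuation (x : K) = O.valuation (ϖ : K) ^ m := by
    intro x hx
    obtain ⟨m, u, rfl⟩ := IsDiscreteValuationRing.eq_unit_mul_pow_irreducible hx hϖ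
    refine ⟨m, ?_⟩
    rw [Subring.coe_mul, Subring.coe_pow, Valuation.map_mul, Valuation.map_pow,
      (O.valuation_eq_one_iff _).mp u.isUnit, one_mul]
  -- `z ∈ O` or `z⁻¹ ∈ O`
  rcases O.mem_or_inv_mem z with h | h
  · obtain ⟨m, hm⟩ := hO ⟨z, h⟩ fun e => hz (congrArg Subtype.val e)
    exact ⟨m, by rw [zpow_natCast]; exact hm⟩
  · obtain ⟨m, hm⟩ := hO ⟨z⁻¹, h⟩ fun e => inv_ne_zero hz (congrArg Subtype.val e)
    refine ⟨-(m : ℤ), ?_⟩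
    rw [zpow_neg, zpow_natCast, ← hm]
    change O.valuation z = (O.valuation z⁻¹)⁻¹
    rw [map_inv₀, inv_inv]

/-- **Registered target `luAlphaPTorsor_of_isDiscreteValuationRing`: the crux
`LuAlphaPTorsor` along every DISCRETE VALUATION RING, in every base dimension, for every
ground field of characteristic `p`.** For `O` a valuation ring of `K ⊇ k` which is a discrete
valuation ring (Noetherian, not a field), `A₀ ⊆ O` finitely generated and regular at the
centre, `t ^ p ∈ A₀` with `Frac (A₀[t]) = K`: some finitely generated `A ⊇ A₀[t]` inside `O`
with `Frac A = K` is regular at the centre. Corollary of `luAlphaPTorsor_of_discrete` with `π`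
a uniformizer of `O`. [folklore] -/
theorem luAlphaPTorsor_of_isDiscreteValuationRing :
    ∀ p : ℕ, p.Prime → ∀ (k K : Type) [Field k] [CharP k p] [Field K] [Algebra k K] (O : ValuationSubring K) (A₀ : Subalgebra k K) (h₀ : A₀.toSubring ≤ O.toSubring) (t : K), A₀.FG → t ^ p ∈ A₀ → IsFractionRing (Algebra.adjoin k (insert t (A₀ : Set K))) K → IsRegularLocalRing (Localization.AtPrime (Ideal.comap (Subring.inclusion h₀) (IsLocalRing.maximalIdeal O))) → IsDiscreteValuationRing O → ∃ (A : Subalgebra k K) (h : A.toSubring ≤ O.toSubring), A₀ ≤ A ∧ t ∈ A ∧ A.FG ∧ IsFractionRing A K ∧ IsRegularLocalRing (Localization.AtPrime (Ideal.comap (Subring.inclusion h) (IsLocalRing.maximalIdeal O))) := by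
  intro p hp k K _ _ _ _ O A₀ h₀ t hfg htp hfr hreg hDVR
  haveI := hDVR
  obtain ⟨ϖ, hϖ⟩ := IsDiscreteValuationRing.exists_irreducible O
  refine luAlphaPTorsor_of_discrete p hp k K O A₀ h₀ t hfg htp hfr hreg ⟨(ϖ : K), ?_, ?_,
    exists_zpow_valuation_of_isDiscreteValuationRing O hϖ⟩
  · exact fun e => hϖ.ne_zero (Subtype.ext e)
  · refine (O.valuation_lt_one_iff ϖ).mp ?_
    rw [(IsDiscreteValuationRing.irreducible_iff_uniformizer ϖ).mp hϖ]
    exact Ideal.mem_span_singleton_self ϖ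

end Summit.ResolutionOfSingularities.ResolutionOfSingularities.Theorems.PfaffLine
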